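import Literature.Probability.Percolation.TriBoundaryLoopWinding
import HarnessLib

/-!
# The inner approximation: tethers, no interleaving, orientation of the boundary

Topic `Literature/Probability/Percolation`; family `crit-perc`. Specialisation of the winding
results for unions of tiles (`no_interleaving`, `TriBoundaryWinding.lean`; `wind_bdryLoop_meshCenter_eq_one`,
`TriBoundaryLoopWinding.lean`) to the inner approximation `innerApprox D hδ hc₀` of a Jordan domain
(`TriInnerApprox.lean`), the domain `G_δ⁻` of Bollobás–Riordan, *Percolation* (2006), Ch. 7 Lemma 14
(pp. 184, 190–191): its coarse set is connected and has no holes, its sites are deep inside `D`, and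
every boundary dart carries a tether (`innerTether`, a choice from `exists_tether`).

## References

* B. Bollobás, O. Riordan, *Percolation*, Cambridge University Press (2006), Ch. 7 Lemma 14 p. 184,
  §7.2.5 pp. 190–191.

## Mathlib / tree

Tree: `TriInnerApprox.lean` (`innerApprox`, `pathIn_innerComp`, `pathIn_compl_of_innerComp`,
`closedBall_subset_of_mem_innerApprox`, `mem_innerComp_self`), `TriTethers.lean` (`exists_tether`),
`TriBoundaryWinding.lean` (`no_interleaving`), `TriBoundaryLoopWinding.lean` (`wind_bdryLoop_meshCenter_eq_one`).
-/

noncomputable section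

open Set Metric Literature.Topology.PlaneTopology Literature.Probability.LatticeModels Literature.Probability.RandomPlanarGeometry

namespace Literature.Probability.Percolation

section InnerApprox

variable (D : JordanDomain) {δ : ℝ} (hδ : 0 < δ) {c₀ : Site 2} (hc₀ : c₀ ∈ innerCoarse D.carrier δ)

/-- **The coarse set of the inner approximation is connected.** [folklore] -/
theorem innerCompFinset_conn : ∀ c ∈ innerCompFinset D hδ c₀, ∀ c' ∈ innerCompFinset D hδ c₀,
    PathIn triGraph (↑(innerCompFinset D hδ c₀) : Set (Site 2)) c c' := fun c hc c' hc' => by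
  rw [coe_innerCompFinset]
  exact pathIn_innerComp ((mem_innerCompFinset D hδ c₀).1 hc) ((mem_innerCompFinset D hδ c₀).1 hc')

/-- **The coarse set of the inner approximation has no holes.** [folklore] -/
theorem innerCompFinset_noHoles : ∀ o ∉ innerCompFinset D hδ c₀, ∀ o' ∉ innerCompFinset D hδ c₀,
    PathIn triGraph ((↑(innerCompFinset D hδ c₀) : Set (Site 2))ᶜ) o o' := fun _ ho _ ho' =>
  pathIn_compl_of_innerComp D hδ (coe_innerCompFinset D hδ c₀) ho ho'

/-- The coarse set of the inner approximation is nonempty (it contains the base coarse site). [folklore] -/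
theorem innerCompFinset_nonempty (hc₀ : c₀ ∈ innerCoarse D.carrier δ) : (innerCompFinset D hδ c₀).Nonempty :=
  ⟨c₀, (mem_innerCompFinset D hδ c₀).2 (mem_innerComp_self hc₀)⟩

/-- The sites of the inner approximation are deep inside the domain: the closed `2δ`-balls about
their mesh points lie in `D`. [folklore] -/
theorem innerApprox_deep : ∀ g ∈ (innerApprox D hδ hc₀).verts, closedBall (triMeshPoint δ g) (2 * δ) ⊆ D.carrier :=
  fun _ hg => closedBall_subset_of_mem_innerApprox D hδ hc₀ hg

/-- **The tether of the `n`-th boundary dart of the inner approximation** (a choice from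
`exists_tether`). [folklore] -/
def innerTether (n : ℕ) :
    Tether D.carrier (innerApprox D hδ hc₀).verts δ (bdryTail (innerApprox D hδ hc₀).verts (innerApprox D hδ hc₀).base n)
      (triBdryIter (innerApprox D hδ hc₀).verts (innerApprox D hδ hc₀).base n).2 :=
  Classical.choice (exists_tether D hδ hc₀ (triBdryIter_mem (innerApprox D hδ hc₀).isTriDisc.base_mem n))

/-- **No interleaving for the inner approximation** (`no_interleaving` with the tethers
`innerTether`): along an arc `∂D([σa, σb])` there are no positions
`n₁ ≤ n₁ + k₂ < n₁ + k₃ < n₁ + k₄ < n₁ + #∂G` with the tips at `n₁`, `n₁ + k₃` on the arc and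
those at `n₁ + k₂`, `n₁ + k₄` at distance `> 48δ` from it. [cite: BollobasRiordan2006, Ch. 7 Lemma 14 p. 184, p. 191] -/
theorem innerApprox_no_interleaving {σa σb : ℝ} {n₁ k₂ k₃ k₄ : ℕ} (h23 : k₂ < k₃) (h34 : k₃ < k₄)
    (h4N : k₄ < (triBdryDarts (innerApprox D hδ hc₀).verts).card)
    (h1 : (innerTether D hδ hc₀ n₁).tip ∈ D.boundary '' Icc σa σb)
    (h3 : (innerTether D hδ hc₀ (n₁ + k₃)).tip ∈ D.boundary '' Icc σa σb)
    (hfar2 : ∀ x ∈ D.boundary '' Icc σa σb, 48 * δ < dist (innerTether D hδ hc₀ (n₁ + k₂)).tip x)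
    (hfar4 : ∀ x ∈ D.boundary '' Icc σa σb, 48 * δ < dist (innerTether D hδ hc₀ (n₁ + k₄)).tip x) : False :=
  no_interleaving (innerApprox D hδ hc₀).isTriDisc (innerCompFinset_conn D hδ) D hδ (innerApprox_deep D hδ hc₀)
    (innerTether D hδ hc₀) h23 h34 h4N h1 h3 hfar2 hfar4

/-- **The boundary of the inner approximation is traversed anticlockwise**: its closed tail polyline
winds once about the centre of each of its faces. [cite: BollobasRiordan2006, Ch. 7 §7.2.2 p. 169] -/
theorem innerApprox_wind_bdryLoop_eq_one {F : HexVertex} (hF : hexFaceVertices F ⊆ (innerApprox D hδ hc₀).verts) :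
    wind (fun s => (tailPoly δ (innerApprox D hδ hc₀).verts (innerApprox D hδ hc₀).base 0
      (triBdryDarts (innerApprox D hδ hc₀).verts).card).extend s - meshCenter δ F) = 1 :=
  wind_bdryLoop_meshCenter_eq_one (innerApprox D hδ hc₀).isTriDisc (innerCompFinset_nonempty D hδ hc₀)
    (innerCompFinset_conn D hδ) (innerCompFinset_noHoles D hδ) hδ hF

end InnerApprox

end Literature.Probability.Percolation
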